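import Mathlib
import HarnessLib
import Summits.HubbardSuperconductivity.HubbardSuperconductivity.Theorems.KLProgrammeKLRegimeEngineTowerReadout

/-!
# Route `KLProgramme` — crux K3 ENGINE (stmt-HubbardSuperconductivity-20437 `KLRegimeEngineV17F2`), stub (b): the blocked-tower bookkeeping,
# part 7b — the read-out profile as ONE geometric law `A_pub · λ^{p−1} · Q_pub^p` (E1 lead r2d-p2 g8; E1-LEVELS-BLUEPRINT-g8 (I6))

Part 7 (`towerReadout_le`) bounds the public degree-`2p` size at a read-out level by
`λ^{p−1}·((if p = 3 then ι₃ else A″Q″^p) + A″(4Q″)^p·X₁ + e·ψ·(2τψQ″)^{p−1}·τY·Z)` — a sum of three geometric profiles in `p`.  The model read-out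
(blueprint (I6)) feeds this into part 15's units row `law_mul_units_le_klWtBudget`, which wants ONE law `A·(Bl·ε_j)^{p−1}·Q^p` with `A·Q ≤ CE`, `Bl·Q ≤ CE`.
This file is the one-line bridge:

* `readoutProfile_le_geometric` — for nonnegative data (every `p`),
  `(if p = 3 then ι₃ else A″Q″^p) + A″(4Q″)^p·X + e·ψ·(2τψQ″)^{p−1}·W ≤ (ι₃ + A″ + A″·X + e·ψ·W) · (max 1 (max (4Q″) (2τψQ″)))^p`;
* **`towerReadout_le_geometric`** — part 7's `towerReadout_le` in that form: `pub ≤ A_pub · λ^{p−1} · Q_pub^p` with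
  `Q_pub := max 1 (max (4Q″) (2τψQ″))` and `A_pub := ι₃ + A″ + A″·x₁/(1−x₁) + e·ψ·τY·y/(1−y)` — `p`-free numbers, so the public per-leg-pair constant
  and amplitude of the levels law are read off directly (the levels threshold `CEℓ ≥ max (A_pub·Q_pub) (B·Q_pub)`).
Pure real analysis; nothing about the model is asserted.
-/

noncomputable section

namespace Summit.HubbardSuperconductivity.HubbardSuperconductivity.Theorems.EngineV8

set_option linter.dupNamespace false -- summit = problem name (single-conjunct summit), D-0017

open Real Finset

/-- **Three geometric profiles under one.**  For every `p` and nonnegative `ι₃, A″, Q″, X, W, ψ, τ`: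
`(if p = 3 then ι₃ else A″Q″^p) + A″(4Q″)^p·X + e·ψ·(2τψQ″)^{p−1}·W ≤ (ι₃ + A″ + A″X + eψW) · (max 1 (max (4Q″) (2τψQ″)))^p`. -/
theorem readoutProfile_le_geometric {ι₃ A'' Q'' X W ψ τ : ℝ} (hι₃ : 0 ≤ ι₃) (hA'' : 0 ≤ A'') (hQ'' : 0 ≤ Q'') (hX : 0 ≤ X) (hW : 0 ≤ W)
    (hψ : 0 ≤ ψ) (hτ : 0 ≤ τ) (p : ℕ) :
    (if p = 3 then ι₃ else A'' * Q'' ^ p) + A'' * (4 * Q'') ^ p * X + exp 1 * ψ * (2 * τ * ψ * Q'') ^ (p - 1) * W ≤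
      (ι₃ + A'' + A'' * X + exp 1 * ψ * W) * (max 1 (max (4 * Q'') (2 * τ * ψ * Q''))) ^ p := by
  set R := max 1 (max (4 * Q'') (2 * τ * ψ * Q'')) with hR
  have hR1 : 1 ≤ R := le_max_left _ _
  have hR0 : 0 ≤ R := zero_le_one.trans hR1
  have h4Q : 4 * Q'' ≤ R := (le_max_left _ _).trans (le_max_right _ _)
  have h2τ : 2 * τ * ψ * Q'' ≤ R := (le_max_right _ _).trans (le_max_right _ _)
  have hQR : Q'' ≤ R := le_trans (by linarith) h4Q
  have hRp1 : 1 ≤ R ^ p := one_le_pow₀ hR1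
  -- term 1
  have h1 : (if p = 3 then ι₃ else A'' * Q'' ^ p) ≤ (ι₃ + A'') * R ^ p := by
    split_ifs with h3
    · calc ι₃ = ι₃ * 1 := (mul_one _).symm
        _ ≤ ι₃ * R ^ p := mul_le_mul_of_nonneg_left hRp1 hι₃
        _ ≤ (ι₃ + A'') * R ^ p := by gcongr; linarith
    · calc A'' * Q'' ^ p ≤ A'' * R ^ p := mul_le_mul_of_nonneg_left (pow_le_pow_left₀ hQ'' hQR p) hA''
        _ ≤ (ι₃ + A'') * R ^ p := by gcongr; linarith
  -- term 2
  have h2 : A'' * (4 * Q'') ^ p * X ≤ A'' * X * R ^ p := by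
    calc A'' * (4 * Q'') ^ p * X = A'' * X * (4 * Q'') ^ p := by ring
      _ ≤ A'' * X * R ^ p := mul_le_mul_of_nonneg_left (pow_le_pow_left₀ (by positivity) h4Q p) (mul_nonneg hA'' hX)
  -- term 3
  have h3 : exp 1 * ψ * (2 * τ * ψ * Q'') ^ (p - 1) * W ≤ exp 1 * ψ * W * R ^ p := by
    have hpow : (2 * τ * ψ * Q'') ^ (p - 1) ≤ R ^ p :=
      (pow_le_pow_left₀ (by positivity) h2τ (p - 1)).trans (pow_le_pow_right₀ hR1 (Nat.sub_le p 1))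
    calc exp 1 * ψ * (2 * τ * ψ * Q'') ^ (p - 1) * W = exp 1 * ψ * W * (2 * τ * ψ * Q'') ^ (p - 1) := by ring
      _ ≤ exp 1 * ψ * W * R ^ p := mul_le_mul_of_nonneg_left hpow (by positivity)
  calc _ ≤ (ι₃ + A'') * R ^ p + A'' * X * R ^ p + exp 1 * ψ * W * R ^ p := add_le_add (add_le_add h1 h2) h3
    _ = (ι₃ + A'' + A'' * X + exp 1 * ψ * W) * R ^ p := by ring

/-- **The read-out as ONE geometric law.**  Under the hypotheses of part 7's `towerReadout_le`, for `3 ≤ p ≤ D`: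
`pub ≤ A_pub · λ^{p−1} · Q_pub^p` with `Q_pub := max 1 (max (4Q″) (2τψQ″))` and
`A_pub := ι₃ + A″ + A″·(x₁/(1−x₁)) + e·ψ·(τY·(y/(1−y)))`, `x₁ = 4σλQ″`, `Y = ι₁λ + ι₂/(2Q″) + ι₃/(4Q″²) + A″Q″/4`, `y = ΦτY` — the shape part 15's
`law_mul_units_le_klWtBudget` consumes. -/
theorem towerReadout_le_geometric {D : ℕ} {μ : ℕ → ℝ} {pub inc σ Φ ψ τ lam A'' Q'' ι₁ ι₂ ι₃ : ℝ}
    (hσ : 0 ≤ σ) (hΦ : 0 ≤ Φ) (hψ : 0 ≤ ψ) (hτ : 0 < τ) (hlam : 0 < lam) (hA'' : 0 ≤ A'') (hQ'' : 0 < Q'') (hι₃ : 0 ≤ ι₃)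
    (hμ0 : ∀ m, 0 ≤ μ m) (hι₁ : μ 1 ≤ ι₁ * lam) (hι₂ : μ 2 ≤ ι₂ * lam) (hι₃' : μ 3 ≤ ι₃ * lam ^ 2)
    (hprof : ∀ m, 4 ≤ m → m ≤ D → μ m ≤ A'' * lam ^ (m - 1) * Q'' ^ m)
    (hx₁ : 4 * σ * lam * Q'' < 1) (hx₂ : 2 * lam * τ * Q'' ≤ 1) (hx₃ : exp 1 * τ * lam * Q'' < 1)
    (hy : Φ * (τ * (ι₁ * lam + ι₂ / (2 * Q'') + ι₃ / (4 * Q'' ^ 2) + A'' * Q'' / 4)) < 1)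
    (hθ : Φ * (exp 1 * τ * (ι₁ * lam) + (exp 1 * τ) ^ 2 * (ι₂ * lam) + (exp 1 * τ) ^ 3 * (ι₃ * lam ^ 2) +
      A'' * (exp 1 * τ * Q'') * ((exp 1 * τ * lam * Q'') ^ 3 / (1 - exp 1 * τ * lam * Q''))) < 1)
    {p : ℕ} (hp : 3 ≤ p) (hpD : p ≤ D) (hpub : pub ≤ μ p + inc)
    (hstep : ∀ N : ℕ, 2 ≤ N → Φ * towerV D τ μ < 1 →
      inc ≤ towerFO D σ μ p + ∑ n ∈ Icc 2 N, exp 1 * Φ ^ (n - 1) * ψ ^ p * towerS D τ μ n p +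
        ψ ^ p * exp 1 * towerV D τ μ * (Φ * towerV D τ μ) ^ N / (1 - Φ * towerV D τ μ)) :
    pub ≤ (ι₃ + A'' + A'' * (4 * σ * lam * Q'' / (1 - 4 * σ * lam * Q'')) +
        exp 1 * ψ * (τ * (ι₁ * lam + ι₂ / (2 * Q'') + ι₃ / (4 * Q'' ^ 2) + A'' * Q'' / 4) *
          (Φ * (τ * (ι₁ * lam + ι₂ / (2 * Q'') + ι₃ / (4 * Q'' ^ 2) + A'' * Q'' / 4)) /
            (1 - Φ * (τ * (ι₁ * lam + ι₂ / (2 * Q'') + ι₃ / (4 * Q'' ^ 2) + A'' * Q'' / 4)))))) *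
      lam ^ (p - 1) * (max 1 (max (4 * Q'') (2 * τ * ψ * Q''))) ^ p := by
  have h := towerReadout_le (D := D) hσ hΦ hψ hτ hlam hA'' hQ'' hμ0 hι₁ hι₂ hι₃' hprof hx₁ hx₂ hx₃ hy hθ hp hpD hpub hstep
  set Y := ι₁ * lam + ι₂ / (2 * Q'') + ι₃ / (4 * Q'' ^ 2) + A'' * Q'' / 4 with hY
  have hX : 0 ≤ 4 * σ * lam * Q'' / (1 - 4 * σ * lam * Q'') := div_nonneg (by positivity) (sub_nonneg.2 hx₁.le)
  -- `0 ≤ Y`: from `0 ≤ μ 1 ≤ ι₁ λ`, `0 ≤ μ 2 ≤ ι₂ λ` (so `0 ≤ ι₁ λ`, `0 ≤ ι₂`), `0 ≤ ι₃`, `0 ≤ A″Q″`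
  have hι₁l : 0 ≤ ι₁ * lam := (hμ0 1).trans hι₁
  have hι₂0 : 0 ≤ ι₂ := le_of_mul_le_mul_right (by rw [zero_mul]; exact (hμ0 2).trans hι₂) hlam
  have hY0 : 0 ≤ Y := by rw [hY]; positivity
  have hW : 0 ≤ τ * Y * (Φ * (τ * Y) / (1 - Φ * (τ * Y))) :=
    mul_nonneg (mul_nonneg hτ.le hY0) (div_nonneg (by positivity) (sub_nonneg.2 hy.le))
  have hgeo := readoutProfile_le_geometric hι₃ hA'' hQ''.le hX hW hψ hτ.le p
  calc pub ≤ _ := h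
    _ = lam ^ (p - 1) * ((if p = 3 then ι₃ else A'' * Q'' ^ p) + A'' * (4 * Q'') ^ p * (4 * σ * lam * Q'' / (1 - 4 * σ * lam * Q'')) +
        exp 1 * ψ * (2 * τ * ψ * Q'') ^ (p - 1) * (τ * Y * (Φ * (τ * Y) / (1 - Φ * (τ * Y))))) := by rw [hY]; ring
    _ ≤ lam ^ (p - 1) * ((ι₃ + A'' + A'' * (4 * σ * lam * Q'' / (1 - 4 * σ * lam * Q'')) +
        exp 1 * ψ * (τ * Y * (Φ * (τ * Y) / (1 - Φ * (τ * Y))))) * (max 1 (max (4 * Q'') (2 * τ * ψ * Q''))) ^ p) :=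
      mul_le_mul_of_nonneg_left hgeo (pow_nonneg hlam.le _)
    _ = _ := by rw [hY]; ring

end Summit.HubbardSuperconductivity.HubbardSuperconductivity.Theorems.EngineV8

end
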